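import Summits.BirchSwinnertonDyer.BirchSwinnertonDyer.Theorems.ResidualThetaTransportAtTwoHeckeThetaPartnerAdicAtTwoHeckeThetaNebentypus
import Summits.BirchSwinnertonDyer.BirchSwinnertonDyer.Theorems.ResidualThetaTransportAtTwoHeckeThetaHigherWeightClass
import HarnessLib

/-!
# The order-`n` Hecke theta series has trivial Nebentypus: `κ(d) χₙ(d) = 1` (`n` odd)
# (toward X_k for `Ribet1977_cmNewform_gamma0_of_isGrossencharakter`, stmt-BirchSwinnertonDyer-24141)

Order-`n` analogue of `…HeckeThetaNebentypus` (the case `n = 1`).  THEOREMS ONLY.  Prepared by the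
literature-prover seat `bsd-input-ribet77-cm-newform-g0` as EVIDENCE (Summit `Theorems/` is prover-only).

With `χₑ(x) = ψ̃_𝔪((x))/σ(x)ᵉ` for a weight-`(e+1)` Größencharakter whose values on odd naturals `n`
prime to `|d_K| N𝔪` are `(d_K/n) nᵉ` (the clause of the fact): `κ(d) χₑ(d) = 1` for every integer
`d` prime to `|d_K| N𝔪` when `e` is odd (`kappa_mul_chiPow_eq_one`).  The case of even `e` (odd
weight) does not occur: see `Literature…CMNewformGamma0NebentypusProofs.even_weight_of_trivial_nebentypus`.

BSD is not proved by this file.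
-/

set_option autoImplicit false
set_option linter.dupNamespace false

noncomputable section

open scoped NumberField ComplexConjugate Real
open NumberField Module Complex IsDedekindDomain

namespace Summit.BirchSwinnertonDyer.BirchSwinnertonDyer.Theorems.HeckeTheta

open Literature.NumberTheory.LFunctions (idealPow rayClassCoeff)

variable {K : Type} [Field K] [NumberField K]

/-- **Odd positive `n` prime to `|d_K| M`: `κ(n) χₑ(n) = 1`**, `χₑ(n) = ψ̃_𝔪((n))/nᵉ = (d_K/n)`. -/
theorem kappa_mul_chiPow_eq_one_of_odd (σ : K →+* ℂ)
    {κ : DirichletCharacter ℂ (discr K).natAbs} (hκJ : ∀ n : ℕ, Odd n → κ n = (jacobiSym (discr K) n : ℂ))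
    {𝔪 : Ideal (𝓞 K)} {ψ : HeightOneSpectrum (𝓞 K) → ℂ} {e : ℕ}
    (hneb : ∀ n : ℕ, Odd n → n.Coprime ((discr K).natAbs * Ideal.absNorm 𝔪) →
      idealPow K ψ (Ideal.span {(n : 𝓞 K)}) = (jacobiSym (discr K) n : ℂ) * (n : ℂ) ^ e)
    {n : ℕ} (hodd : Odd n) (hcop : n.Coprime ((discr K).natAbs * Ideal.absNorm 𝔪)) :
    κ n * (rayClassCoeff 𝔪 ψ (Ideal.span {((n : ℤ) : 𝓞 K)}) / σ ((((n : ℤ) : 𝓞 K)) : K) ^ e) = 1 := by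
  classical
  have hn0 : n ≠ 0 := by rintro rfl; exact (Nat.not_odd_zero hodd).elim
  have hspan : Ideal.span {((n : ℤ) : 𝓞 K)} = Ideal.span {(n : 𝓞 K)} := by push_cast; rfl
  have hne : Ideal.span {(n : 𝓞 K)} ≠ ⊥ := by
    rw [Ne, Ideal.span_singleton_eq_bot]; exact_mod_cast hn0
  have hcopM : IsCoprime (Ideal.span {(n : 𝓞 K)}) 𝔪 :=
    isCoprime_span_natCast (Nat.Coprime.coprime_mul_left_right hcop)
  rw [hspan, rayClassCoeff, if_pos ⟨hne, hcopM⟩, hneb n hodd hcop, hκJ n hodd]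
  have hσ : σ ((((n : ℤ) : 𝓞 K)) : K) = (n : ℂ) := by simp
  rw [hσ, mul_div_assoc, div_self (pow_ne_zero _ (by exact_mod_cast hn0 : (n : ℂ) ≠ 0)), mul_one]
  have hgcd : (discr K).gcd (n : ℤ) = 1 := by
    have h1 : n.Coprime (discr K).natAbs := Nat.Coprime.coprime_mul_right_right hcop
    rw [Int.gcd_eq_natAbs, Int.natAbs_natCast]
    exact Nat.Coprime.symm h1
  rcases jacobiSym.eq_one_or_neg_one hgcd with h | h <;> rw [h] <;> norm_num


/-- **Trivial Nebentypus at weight `e + 1`, `e` odd: `κ(d) χₑ(d) = 1` for every integer `d` prime to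
`|d_K| M`** (`χₑ(d) = ψ̃_𝔪((d))/dᵉ`; for `d < 0` both `κ` and `χₑ` change sign, `e` being odd). -/
theorem kappa_mul_chiPow_eq_one (hK : finrank ℚ K = 2) (σ : K →+* ℂ)
    {κ : DirichletCharacter ℂ (discr K).natAbs} (hκodd : κ.Odd)
    (hκJ : ∀ n : ℕ, Odd n → κ n = (jacobiSym (discr K) n : ℂ))
    {𝔪 : Ideal (𝓞 K)} (h𝔪 : 𝔪 ≠ ⊥) {ψ : HeightOneSpectrum (𝓞 K) → ℂ} {e : ℕ} (he : Odd e)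
    (hψ : ∀ b c : 𝓞 K, b ≠ 0 → c ≠ 0 → IsCoprime (Ideal.span {c}) 𝔪 → b - c ∈ 𝔪 →
      idealPow K ψ (Ideal.span {b}) = idealPow K ψ (Ideal.span {c}) * σ ((b : K) / c) ^ e)
    (hneb : ∀ n : ℕ, Odd n → n.Coprime ((discr K).natAbs * Ideal.absNorm 𝔪) →
      idealPow K ψ (Ideal.span {(n : 𝓞 K)}) = (jacobiSym (discr K) n : ℂ) * (n : ℂ) ^ e)
    {d : ℤ} (hd : IsCoprime d (((discr K).natAbs * Ideal.absNorm 𝔪 : ℕ) : ℤ)) :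
    κ (d : ZMod (discr K).natAbs) *
      (rayClassCoeff 𝔪 ψ (Ideal.span {(d : 𝓞 K)}) / σ ((d : 𝓞 K) : K) ^ e) = 1 := by
  classical
  set M : ℕ := Ideal.absNorm 𝔪 with hMdef
  have hM : M ≠ 0 := by rw [hMdef, Ne, Ideal.absNorm_eq_zero_iff]; exact h𝔪
  have hD3 : 2 < (discr K).natAbs := by
    have h := NumberField.abs_discr_gt_two (K := K) (by rw [hK]; norm_num)
    have : (2 : ℤ) < ((discr K).natAbs : ℤ) := by rw [Int.natCast_natAbs]; exact h
    exact_mod_cast this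
  have hN1 : (discr K).natAbs * M ≠ 1 := by
    intro h
    have := Nat.eq_one_of_mul_eq_one_right h
    omega
  -- `|d_K| M ∈ 𝔪`
  have hNmem : (((((discr K).natAbs * M : ℕ) : ℤ)) : 𝓞 K) ∈ 𝔪 := by
    rw [Int.cast_natCast, Nat.cast_mul]
    exact Ideal.mul_mem_left _ _ (Ideal.absNorm_mem 𝔪)
  -- positive integers
  have hnat : ∀ m : ℕ, m.Coprime ((discr K).natAbs * M) →
      κ ((m : ℤ) : ZMod (discr K).natAbs) *
        (rayClassCoeff 𝔪 ψ (Ideal.span {((m : ℤ) : 𝓞 K)}) / σ ((((m : ℤ) : 𝓞 K)) : K) ^ e) = 1 := by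
    intro m hm
    have hm0 : m ≠ 0 := by
      rintro rfl
      exact hN1 ((Nat.coprime_zero_left _).mp hm)
    rcases Nat.even_or_odd m with heven | hodd
    · -- `m` even: `|d_K| M` is odd, use `m' = m + |d_K| M`
      have hNodd : Odd ((discr K).natAbs * M) := by
        rw [← Nat.not_even_iff_odd]
        intro hNe
        have h2 : 2 ∣ Nat.gcd m ((discr K).natAbs * M) :=
          Nat.dvd_gcd (even_iff_two_dvd.mp heven) (even_iff_two_dvd.mp hNe)
        rw [hm] at h2
        omega
      have hm'odd : Odd (m + (discr K).natAbs * M) := heven.add_odd hNodd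
      have hm'cop : (m + (discr K).natAbs * M).Coprime ((discr K).natAbs * M) := by
        have := (Nat.coprime_add_mul_right_left m ((discr K).natAbs * M) 1).mpr hm
        simpa using this
      have h1 := kappa_mul_chiPow_eq_one_of_odd σ hκJ hneb hm'odd hm'cop
      have hκ : κ (((m + (discr K).natAbs * M : ℕ) : ℤ) : ZMod (discr K).natAbs) =
          κ ((m : ℤ) : ZMod (discr K).natAbs) := by
        congr 1
        simp only [Nat.cast_add, Nat.cast_mul, Int.cast_add, Int.cast_mul, Int.cast_natCast,
          ZMod.natCast_self, zero_mul, add_zero]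
      have hχ : rayClassCoeff 𝔪 ψ (Ideal.span {(((m + (discr K).natAbs * M : ℕ) : ℤ) : 𝓞 K)}) /
            σ (((((m + (discr K).natAbs * M : ℕ) : ℤ) : 𝓞 K)) : K) ^ e =
          rayClassCoeff 𝔪 ψ (Ideal.span {((m : ℤ) : 𝓞 K)}) / σ ((((m : ℤ) : 𝓞 K)) : K) ^ e := by
        refine chiPow_periodic σ hψ ?_ ?_ ?_
        · exact_mod_cast hm'odd.pos.ne'
        · exact_mod_cast hm0
        · have : (((m + (discr K).natAbs * M : ℕ) : ℤ) : 𝓞 K) - ((m : ℤ) : 𝓞 K) =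
              ((((discr K).natAbs * M : ℕ) : ℤ) : 𝓞 K) := by
            push_cast; ring
          rw [this]; exact hNmem
      rw [← hκ, ← hχ]
      exact_mod_cast h1
    · exact_mod_cast kappa_mul_chiPow_eq_one_of_odd σ hκJ hneb hodd hm
  -- integers
  have hgcd : Nat.Coprime d.natAbs ((discr K).natAbs * M) := by
    have h := Int.isCoprime_iff_gcd_eq_one.mp hd
    rw [Int.gcd_eq_natAbs, Int.natAbs_natCast] at h
    exact h
  rcases Int.natAbs_eq d with h | h
  · rw [h]; exact hnat _ hgcd
  · have h1 := hnat _ hgcd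
    rw [h]
    have hκneg : κ (((-(d.natAbs : ℤ) : ℤ)) : ZMod (discr K).natAbs) =
        -κ (((d.natAbs : ℤ)) : ZMod (discr K).natAbs) := by
      rw [Int.cast_neg, neg_eq_neg_one_mul (((d.natAbs : ℤ) : ZMod (discr K).natAbs)), map_mul]
      rw [show κ (-1) = -1 from hκodd]
      ring
    have hχneg : rayClassCoeff 𝔪 ψ (Ideal.span {((-(d.natAbs : ℤ) : ℤ) : 𝓞 K)}) /
          σ ((((-(d.natAbs : ℤ) : ℤ) : 𝓞 K)) : K) ^ e =
        -(rayClassCoeff 𝔪 ψ (Ideal.span {((d.natAbs : ℤ) : 𝓞 K)}) / σ ((((d.natAbs : ℤ) : 𝓞 K)) : K) ^ e) := by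
      rw [Int.cast_neg, Ideal.span_singleton_neg]
      push_cast
      rw [map_neg, he.neg_pow, div_neg]
    rw [hκneg, hχneg]
    linear_combination h1

end Summit.BirchSwinnertonDyer.BirchSwinnertonDyer.Theorems.HeckeTheta

end
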